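import Mathlib
import Literature.Computability.MetaComplexity.PolynomialCalculus
import Literature.Computability.MetaComplexity.ResLinProverDelayer
import Summits.PneNP.PneNP.Theorems.PstarPDTPolyCalc
import Summits.PneNP.PneNP.Theorems.PstarFibreCNF
import Summits.PneNP.PneNP.Theorems.PstarResLinConjectures

/-!
# A `PC/𝔽₂` degree lower bound gives a Delayer strategy (ROUND-24 item T24.10)

FRONTIER range-avoidance ladder, rung F-N3 (cell `pnp-ideate`; restricted-model proof complexity — nothing here bears on `P`
versus `NP`).

The Garlík–Kołodziejczyk direction «polynomial-calculus degree ⇒ Prover–Delayer coins» for the fibres of pure `P⋆` instances,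
which makes the named open problem T21.2 (`PstarPCDegreeLinear`) the single root of the whole ROUND-24 ladder
(`delayer_of_pcDegree : PstarPCDegreeLinear → PstarDelayerLinear`; the Delayer form already gives tree-like `Res(⊕)` length,
parity-decision-tree size and depth, `PstarResLinConjectures`).

**The Delayer.**  Fix a pure instance `I`, a target `y` and a degree `D` with `¬ PC.RefutableInDegree (fibrePolys I y) D`.  On a board
`Φ` (restricted to the instance's variables `< n`: `resB`) the available axioms are `sys I y Φ = fibrePolys I y ∪ pathAx (resB Φ)` — the
fibre polynomials and the affine polynomials `axOf (f, a) = Σ_{v ∈ f} X_v + a` of the equations on the board.  Asked a form `f` after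
`c` coins, Delayer ANSWERS the value `v` if `sys Φ ⊢ axOf (f↾n, v)` in degree `D − c`, and says `*` otherwise (`ans`, `delayer`).
Invariant (`not_refutable_of_conform`): along every conforming board, `sys Φ` is not refutable in degree `D − coins`.  A forced answer keeps
the degree (the CUT rule `derivable_cut`: a derivable axiom may be inlined); a coin lowers it by one, and if the extended board were
refutable in degree `D − c − 1` then multiplying that refutation through by `g + 1` (`derivable_of_refutable_insert`, the mechanics of
`PstarPDT.refutable_of_split`) would derive the opposite parity `axOf (f↾n, ¬v)` in degree `D − c` — so Delayer would have answered.
When the game ends the board contradicts a clause of `fibreCNF I y`, so every input of the cell of the restricted board violates some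
output (`violates_of_contradicts`) and `PstarPDT.leaf_refutable` refutes `sys Φ` in degree `2`; hence `coins ≥ D − 1`
(`guarantees_delayer`).
-/

set_option linter.dupNamespace false -- `Summit.PneNP.PneNP.…`: summit = sub-problem name (D-0017 single-conjunct layout)

open Finset MvPolynomial Literature.Computability.Complexity Literature.Computability.MetaComplexity
open Literature.Computability.MetaComplexity.ProverDelayer (Strategy Guarantees Conform coins Contradicts coins_cons conform_cons)
open Summit.PneNP.PneNP.Theorems.PstarFibrePolys (bit fibreAxiom fibrePolys derivable_fibreAxiom)
open Summit.PneNP.PneNP.Theorems.PstarFibreCNF (fibreCNF patternClause eval_patternClause_iff)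
open Summit.PneNP.PneNP.Theorems.PstarPDT (parity linPoly axOf pathAx pathAx_nil pathAx_cons derivable_mul_through derivable_zero_of
  totalDegree_boolAx_le totalDegree_axOf_le derivable_linPoly_mul_succ leaf_refutable)
open Summit.PneNP.PneNP.Theorems.PstarResLinConjectures (PstarPCDegreeLinear PstarDelayerLinear PstarTreeResLinExp PstarPDTSizeExp
  treeResLinExp_of_delayer pdtSizeExp_of_delayer)

namespace Summit.PneNP.PneNP.Theorems.PstarDelayerOfPCDegree

/-! ## Two rules of the polynomial calculus -/

section PC

variable {σ F : Type*} [Field F]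

/-- **Cut.**  A derivable polynomial may be used as an extra axiom without changing the degree (inline its derivation). -/
theorem derivable_cut {𝓖 : Set (MvPolynomial σ F)} {D : ℕ} {q f : MvPolynomial σ F} (hq : PC.DerivableInDegree 𝓖 D q)
    (hf : PC.DerivableInDegree (𝓖 ∪ {q}) D f) : PC.DerivableInDegree 𝓖 D f := by
  induction hf with
  | hyp hg hd =>
    rcases hg with hg | hg
    · exact .hyp hg hd
    · rw [Set.mem_singleton_iff] at hg
      rw [hg]
      exact hq
  | booleanAxiom j hd => exact .booleanAxiom j hd
  | add _ _ ih₁ ih₂ => exact ih₁.add ih₂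
  | mul h _ hd ih => exact ih.mul h hd

/-- **Deduction by multiplying through.**  If `𝓖 ∪ {a}` is refutable in degree `D ≥ 2`, `deg k ≤ 1` and `a · k` is derivable from `𝓖`
in degree `D + 1`, then `k` is derivable from `𝓖` in degree `D + 1` (multiply the refutation through by `k`; the axiom `a` becomes
`a · k`). -/
theorem derivable_of_refutable_insert {𝓖 : Set (MvPolynomial σ F)} {D : ℕ} (hD : 2 ≤ D) (a k : MvPolynomial σ F)
    (hk : k.totalDegree ≤ 1) (ha : PC.DerivableInDegree (𝓖 ∪ {a}) D 1) (hak : PC.DerivableInDegree 𝓖 (D + 1) (a * k)) :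
    PC.DerivableInDegree 𝓖 (D + 1) k := by
  have key := derivable_mul_through (𝓖 := 𝓖 ∪ {a}) (𝓕 := 𝓖) (D := D) (D' := D + 1) k (by omega) ?_ ?_ ha
  · simpa using key
  · rintro g (hg | hg) hd
    · exact (PC.DerivableInDegree.hyp hg (hd.trans (Nat.le_succ D))).mul k ((totalDegree_mul _ _).trans (by omega))
    · rw [Set.mem_singleton_iff] at hg
      subst hg
      exact hak
  · intro j _
    have hb := totalDegree_boolAx_le (F := F) j
    exact (PC.DerivableInDegree.booleanAxiom j (hb.trans (by omega))).mul k ((totalDegree_mul _ _).trans (by omega))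

end PC

variable {n m : ℕ}

/-- The product of the two axiom polynomials of a parity form is `g (g + 1)`. -/
theorem axOf_mul_axOf_not (S : Finset (Fin n)) (a : Bool) : axOf (S, a) * axOf (S, !a) = linPoly S * (linPoly S + 1) := by
  cases a
  · simp only [axOf, bit, Bool.false_eq_true, if_false, map_zero, add_zero, Bool.not_false, if_true, map_one]
  · simp only [axOf, bit, if_true, map_one, Bool.not_true, Bool.false_eq_true, if_false, map_zero, add_zero]
    ring

/-- **Deduction for parity axioms.**  If `𝓖 ∪ {axOf (S, a)}` is refutable in degree `D ≥ 2` (and `𝓖` derives `0`), then `𝓖` derives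
the opposite parity `axOf (S, ¬a)` in degree `D + 1`. -/
theorem derivable_not_of_refutable {𝓖 : Set (MvPolynomial (Fin n) (ZMod 2))} {D : ℕ} (hD : 2 ≤ D) (S : Finset (Fin n)) (a : Bool)
    (h0 : PC.DerivableInDegree 𝓖 (D + 1) 0) (h : PC.DerivableInDegree (𝓖 ∪ {axOf (S, a)}) D 1) :
    PC.DerivableInDegree 𝓖 (D + 1) (axOf (S, !a)) := by
  refine derivable_of_refutable_insert hD (axOf (S, a)) (axOf (S, !a)) (totalDegree_axOf_le _) h ?_
  rw [axOf_mul_axOf_not]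
  exact derivable_linPoly_mul_succ (by omega) h0 S

/-! ## Boards restricted to the instance's variables -/

/-- An `ℕ`-indexed linear form restricted to the variables `< n`. -/
def res (n : ℕ) (f : Finset ℕ) : Finset (Fin n) := univ.filter fun v => v.val ∈ f

/-- A board restricted to the variables `< n`, as a path of parity constraints. -/
def resB (n : ℕ) (Φ : List LinLit) : List (Finset (Fin n) × Bool) := Φ.map fun e => (res n e.1, e.2)

/-- The input `z` extended by `false` outside the instance's variables. -/
def ext (z : Fin n → Bool) (i : ℕ) : Bool := if h : i < n then z ⟨i, h⟩ else false

/-- On a variable of the instance the extension reads the input. -/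
theorem ext_val (z : Fin n → Bool) (v : Fin n) : ext z v.val = z v := by
  simp [ext, v.isLt]

/-- Under the extension of `z`, a board equation holds iff its restriction holds at `z`. -/
theorem eval_ext_iff (z : Fin n → Bool) (f : Finset ℕ) (a : Bool) : LinLit.eval (ext z) (f, a) = true ↔ parity (res n f) z = a := by
  have hc : (f.filter fun i => ext z i = true).card = ((res n f).filter fun v => z v = true).card := by
    rw [← card_map Fin.valEmbedding]
    congr 1
    ext i
    simp only [mem_filter, mem_map, res, mem_univ, true_and, Fin.valEmbedding_apply]
    constructor
    · rintro ⟨hi, he⟩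
      by_cases hlt : i < n
      · refine ⟨⟨i, hlt⟩, ⟨hi, ?_⟩, rfl⟩
        simpa [ext, hlt] using he
      · simp [ext, hlt] at he
    · rintro ⟨v, ⟨hv, hz⟩, rfl⟩
      exact ⟨hv, by rw [ext_val]; exact hz⟩
  unfold LinLit.eval PstarPDT.parity
  rw [decide_eq_true_eq, hc]
  cases a
  · simp only [Bool.toNat_false, decide_eq_false_iff_not, Nat.not_odd_iff_even, Nat.even_iff]
  · simp only [Bool.toNat_true, decide_eq_true_eq, Nat.odd_iff]

/-- If `z` lies in the cell of the restricted board, its extension satisfies the board. -/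
theorem holds_ext (Φ : List LinLit) (z : Fin n → Bool) (hz : ∀ q ∈ resB n Φ, parity q.1 z = q.2) :
    ∀ e ∈ Φ, LinLit.eval (ext z) e = true := by
  intro e he
  have h := hz (res n e.1, e.2) (List.mem_map.2 ⟨e, he, rfl⟩)
  exact (eval_ext_iff z e.1 e.2).2 h

/-- **The end of the game, restricted.**  If the board contradicts a clause of the fibre CNF then every input of the cell of the
restricted board violates some fixed output. -/
theorem violates_of_contradicts (I : LocalMap 4 n m) (y : Fin m → Bool) {Φ : List LinLit} {c : Clause ℕ} (hc : c ∈ fibreCNF I y)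
    (hcon : Contradicts Φ (Clause.toLinClause c)) :
    ∃ j : Fin m, ∀ z : Fin n → Bool, (∀ q ∈ resB n Φ, parity q.1 z = q.2) → I.eval z j ≠ y j := by
  unfold PstarFibreCNF.fibreCNF at hc
  rw [List.mem_flatMap] at hc
  obtain ⟨j, -, hcj⟩ := hc
  unfold PstarFibreCNF.outputClauses at hcj
  rw [List.mem_map] at hcj
  obtain ⟨u, hu, rfl⟩ := hcj
  rw [List.mem_filter, Finset.mem_toList] at hu
  have hu' : I.table j u ≠ y j := by simpa using hu.2
  refine ⟨j, fun z hz => ?_⟩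
  have hfalse := hcon (ext z) (holds_ext Φ z hz)
  rw [eval_toLinClause] at hfalse
  have hcl : ¬ (Clause.eval (ext z) (patternClause I j u) = true) := by
    unfold Clause.eval
    rw [hfalse]
    exact Bool.false_ne_true
  rw [eval_patternClause_iff, not_not] at hcl
  have hzu : (fun i => z (I.vars j i)) = u := by
    rw [← hcl]
    funext i
    rw [ext_val]
  show I.table j (fun i => z (I.vars j i)) ≠ y j
  rw [hzu]
  exact hu'

/-! ## The Delayer strategy -/

section Strategy

variable (I : LocalMap 4 n m) (y : Fin m → Bool) (D : ℕ)

/-- The axioms available on the board `Φ`: the fibre polynomials and the affine polynomials of the (restricted) board equations. -/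
def sys (Φ : List LinLit) : Set (MvPolynomial (Fin n) (ZMod 2)) := fibrePolys I y ∪ pathAx (resB n Φ)

open Classical in
/-- Delayer's answer to the form `f` on the board `Φ` after `c` coins: the value `v` if `sys Φ ⊢ axOf (f↾n, v)` in degree `D − c`
(trying `v = 0` first), else `*`. -/
noncomputable def ans (c : ℕ) (Φ : List LinLit) (f : Finset ℕ) : Option Bool :=
  if PC.DerivableInDegree (sys I y Φ) (D - c) (axOf (res n f, false)) then some false
  else if PC.DerivableInDegree (sys I y Φ) (D - c) (axOf (res n f, true)) then some true
  else none

/-- The coins earned on a board played against `ans` (structural recursion: the answer on `Φ` depends on the coins below). -/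
noncomputable def coinsAux : List LinLit → ℕ
  | [] => 0
  | e :: Φ => coinsAux Φ + if ans I y D (coinsAux Φ) Φ e.1 = none then 1 else 0

/-- **The Delayer** of degree budget `D`. -/
noncomputable def delayer : Strategy := fun Φ f => ans I y D (coinsAux I y D Φ) Φ f

/-- The game's coin count of `delayer` is `coinsAux`. -/
theorem coins_delayer : ∀ Φ : List LinLit, coins (delayer I y D) Φ = coinsAux I y D Φ
  | [] => rfl
  | e :: Φ => by
    rw [coins_cons, coinsAux, coins_delayer Φ]
    rfl

variable {I y D}

/-- An answered value is derivable. -/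
theorem derivable_of_ans_eq_some {c : ℕ} {Φ : List LinLit} {f : Finset ℕ} {b : Bool} (h : ans I y D c Φ f = some b) :
    PC.DerivableInDegree (sys I y Φ) (D - c) (axOf (res n f, b)) := by
  unfold ans at h
  split_ifs at h with h0 h1
  · rw [Option.some.injEq] at h
    rw [← h]
    exact h0
  · rw [Option.some.injEq] at h
    rw [← h]
    exact h1

/-- If some value is derivable, Delayer does not say `*`. -/
theorem ans_ne_none {c : ℕ} {Φ : List LinLit} {f : Finset ℕ} {b : Bool}
    (h : PC.DerivableInDegree (sys I y Φ) (D - c) (axOf (res n f, b))) : ans I y D c Φ f ≠ none := by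
  unfold ans
  split_ifs with h0 h1
  · exact Option.some_ne_none _
  · exact Option.some_ne_none _
  · cases b
    · exact absurd h h0
    · exact absurd h h1

/-- The axioms of an extended board. -/
theorem sys_cons (e : LinLit) (Φ : List LinLit) : sys I y (e :: Φ) = sys I y Φ ∪ {axOf (res n e.1, e.2)} := by
  unfold sys resB
  rw [List.map_cons, pathAx_cons, Set.union_insert, Set.union_singleton]

/-- The axioms of the empty board are the fibre polynomials. -/
theorem sys_nil : sys I y [] = fibrePolys I y := by
  unfold sys resB
  rw [List.map_nil, pathAx_nil, Set.union_empty]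

/-- `0` is derivable from the axioms of any board (some fibre axiom exists). -/
theorem derivable_zero (j₀ : Fin m) (Φ : List LinLit) {d : ℕ} (hd : 2 ≤ d) : PC.DerivableInDegree (sys I y Φ) d 0 :=
  derivable_zero_of ((derivable_fibreAxiom I y j₀ hd).mono_set Set.subset_union_left)

/-- **The invariant.**  Along a conforming board with `c` coins, `c + 2 ≤ D`, the axioms `sys Φ` are not refutable in degree `D − c`. -/
theorem not_refutable_of_conform (j₀ : Fin m) (hD : ¬ PC.RefutableInDegree (fibrePolys I y) D) :
    ∀ Φ : List LinLit, Conform (delayer I y D) Φ → coinsAux I y D Φ + 2 ≤ D →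
      ¬ PC.DerivableInDegree (sys I y Φ) (D - coinsAux I y D Φ) 1
  | [] => by
    intro _ _
    rw [sys_nil]
    exact hD
  | (f, a) :: Φ => by
    intro hconf hc
    rw [conform_cons] at hconf
    obtain ⟨hconf', hans⟩ := hconf
    have hans' : ans I y D (coinsAux I y D Φ) Φ f = none ∨ ans I y D (coinsAux I y D Φ) Φ f = some a := hans
    rw [sys_cons]
    rcases hans' with hnone | hsome
    · -- a coin: the degree budget drops by one
      have hcoins : coinsAux I y D ((f, a) :: Φ) = coinsAux I y D Φ + 1 := by
        show coinsAux I y D Φ + (if ans I y D (coinsAux I y D Φ) Φ f = none then 1 else 0) = _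
        rw [if_pos hnone]
      rw [hcoins] at hc ⊢
      have ih := not_refutable_of_conform j₀ hD Φ hconf' (by omega)
      intro h
      have hdeg : D - (coinsAux I y D Φ + 1) + 1 = D - coinsAux I y D Φ := by omega
      have hnot := derivable_not_of_refutable (by omega) (res n f) a (derivable_zero j₀ Φ (by omega)) h
      rw [hdeg] at hnot
      exact ans_ne_none hnot hnone
    · -- a forced answer: the answered axiom is derivable, cut it
      have hcoins : coinsAux I y D ((f, a) :: Φ) = coinsAux I y D Φ := by
        show coinsAux I y D Φ + (if ans I y D (coinsAux I y D Φ) Φ f = none then 1 else 0) = _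
        rw [if_neg (by rw [hsome]; exact Option.some_ne_none a), add_zero]
      rw [hcoins] at hc ⊢
      have ih := not_refutable_of_conform j₀ hD Φ hconf' hc
      intro h
      exact ih (derivable_cut (derivable_of_ans_eq_some hsome) h)

/-- **T24.10, one instance.**  If the fibre system of a pure `P⋆` instance is not `PC/𝔽₂`-refutable in degree `D`, the Delayer of
budget `D` earns at least `D − 1` coins against every Prover. -/
theorem guarantees_delayer (hI : I.IsPure xorAndPred) (hD : ¬ PC.RefutableInDegree (fibrePolys I y) D) :
    Guarantees (fibreCNF I y) (delayer I y D) (D - 1) := by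
  rintro Φ hconf ⟨c, hc, hcon⟩
  obtain ⟨j, hviol⟩ := violates_of_contradicts I y hc hcon
  have h2 : PC.DerivableInDegree (sys I y Φ) 2 1 := leaf_refutable hI (resB n Φ) j hviol
  rw [coins_delayer]
  by_contra hlt
  push Not at hlt
  have hinv := not_refutable_of_conform j hD Φ hconf (by omega)
  exact hinv (h2.mono (by omega))

end Strategy

/-- **T24.10, existence form**: `PC/𝔽₂` degree `> D` for the fibre system gives a Delayer strategy guaranteeing `D − 1` coins on the
fibre CNF. -/
theorem exists_delayer (I : LocalMap 4 n m) (hI : I.IsPure xorAndPred) (y : Fin m → Bool) {D : ℕ}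
    (hD : ¬ PC.RefutableInDegree (fibrePolys I y) D) : ∃ δ : Strategy, Guarantees (fibreCNF I y) δ (D - 1) :=
  ⟨delayer I y D, guarantees_delayer hI hD⟩

/-- Guaranteeing `t` coins guarantees any `t' ≤ t`. -/
theorem guarantees_mono {φ : CNF ℕ} {δ : Strategy} {t t' : ℕ} (h : Guarantees φ δ t) (ht : t' ≤ t) : Guarantees φ δ t' :=
  fun Φ hconf hend => ht.trans (h Φ hconf hend)

/-! ## The by-name wiring -/

/-- **T24.10 — `PstarPCDegreeLinear → PstarDelayerLinear`.**  A linear `PC/𝔽₂` degree lower bound for the fibres of a pure `P⋆`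
family (the named open problem T21.2) gives Delayer strategies with linearly many coins (`c ↦ 2c`, `n ≥ 2c`). -/
theorem delayer_of_pcDegree (h : PstarPCDegreeLinear) : PstarDelayerLinear := by
  intro C
  obtain ⟨c, hc, hN⟩ := h C
  refine ⟨2 * c, by omega, fun N => ?_⟩
  obtain ⟨n, hn, m, hm, I, hI, hne, hall⟩ := hN (max N (2 * c))
  refine ⟨n, (le_max_left _ _).trans hn, m, hm, I, hI, hne, fun y hy => ?_⟩
  obtain ⟨δ, hδ⟩ := exists_delayer I hI y (hall y hy)
  refine ⟨δ, guarantees_mono hδ ?_⟩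
  have h2c : 2 * c ≤ n := (le_max_right _ _).trans hn
  have hdiv : n / (2 * c) = n / c / 2 := by rw [Nat.div_div_eq_div_mul, mul_comm]
  have hq : 2 ≤ n / c := (Nat.le_div_iff_mul_le hc).2 (by omega)
  rw [hdiv]
  omega

/-- Hence T21.2 gives the tree-like `Res(⊕)` length form. -/
theorem treeResLinExp_of_pcDegree (h : PstarPCDegreeLinear) : PstarTreeResLinExp :=
  treeResLinExp_of_delayer (delayer_of_pcDegree h)

/-- Hence T21.2 gives the parity-decision-tree size form. -/
theorem pdtSizeExp_of_pcDegree (h : PstarPCDegreeLinear) : PstarPDTSizeExp :=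
  pdtSizeExp_of_delayer (delayer_of_pcDegree h)

end Summit.PneNP.PneNP.Theorems.PstarDelayerOfPCDegree
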